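import Literature.AnabelianGeometry.AbsoluteAnabelian.AbsTopIProp410ProfiniteClosednessProofs
import HarnessLib

/-!
# [AbsTopI] Prop 4.10 (i)/(iii): row iii.L02 ⟺ André's basis clause (CF), and (CF) as a property of
# the GEOMETRIC tempered group `Δ^tp_Y` alone (proof-only)

S. Mochizuki, *Topics in Absolute Anabelian Geometry I: Generalities* [AbsTopI] (J. Math. Sci.
Univ. Tokyo 19 (2012)), §0 p. 8, Prop 4.10 (i) p. 60 ("`π₁^tp(X)` [...] is naturally isomorphic to
its `π₁(X)`-co-free completion"; proof p. 60 l. 8–13: for `H ⊆ π₁^tp(X_k̄)` open of finite index,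
"`H ↠ H/H^{co-fr}` corresponds to the tempered covering of `X_k̄` determined by the universal
covering of the dual graph of the special fiber of a stable model", i.e. André's
`π₁^tp = lim π₁^tp/H^{co-fr}`); manuscript pagination, lit key `paper:url-11ac98ba15fc`, read on the
page.  S. Mochizuki, *Semi-graphs of anabelioids* [SemiAnbd] Def 3.1 (i) p. 33, §6 p. 69.

Context: row iii.L02 (`SelfCompletionAt Y`, Prop 4.10 (i) AT THE CONSTRUCTION) of the cell's sub-DAG
`HOME/plan/L4/SUBDAG-AbsTopI-Prop410.md`.  With (PC) proved
(`AbsTopIProp410ProfiniteClosednessProofs.lean`), the row is EQUIVALENT — for `Π^tp_Y` tempered and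
Galois-countable (`dY : Y.GroupLevelData`) and §0 p. 8's standing hypothesis `hmin` — to André's
basis clause

  (CF)  every open normal subgroup of `Π^tp_Y` contains some `H′^{co-fr}` (`H′` a Y-index)

(`selfCompletionAt_iff_cofreeCore_cofinal`), and (CF) is in turn equivalent, by temperedness of
`Π^tp_Y` alone, to the same clause ON THE GEOMETRIC GROUP:

  (CF_Δ)  every open normal subgroup of `Δ^tp_Y` (subspace topology) contains some `H′^{co-fr}`

(`cofreeCore_cofinal_iff_delta`) — the shape in which a construction of `Δ^tp_Y` as the tempered
fundamental group of the reduction semi-graph tower ([SemiAnbd] Prop 3.6, abc-iut-L3) would supply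
it.
Hence `selfCompletionAt_iff_cofreeCore_cofinal_delta` and the closers of BOTH clauses of node (iii)
over (CF_Δ): `prop410iiiAt_of_residues'''`, `prop410iiiDeltaAt_of_residues'''`.

Inputs are hypotheses stated in the signatures (no new named facts; FACT-LIST untouched).  HONEST
FRAMING: refereed prerequisite papers; nothing here bears on [IUTchIII] Cor 3.12; typed ≠ proved.
-/

noncomputable section

open _root_.Topology Filter

namespace Literature.AnabelianGeometry.AbsoluteAnabelian.AbsTopI.Prop410

open Literature.AnabelianGeometry.SemiGraphs
open Literature.AnabelianGeometry.AbsoluteAnabelian.AbsTopI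

variable {p : ℕ} [Fact p.Prime]

/-! ### (CF) ⟺ (CF_Δ): the basis clause lives on `Δ^tp_Y` -/

/-- **(CF_Δ) ⟹ (CF)**: if every open normal subgroup of the geometric group `Δ^tp_Y` contains some
`H′^{co-fr}`, so does every open normal subgroup of `Π^tp_Y` (restrict it to `Δ^tp_Y`).
[cite: MochizukiAbsTopI2012, Prop 4.10 (i) p.60] -/
theorem cofreeCore_cofinal_of_delta {Y : TemperedCurve p}
    (hΔ : ∀ N : OpenNormalSubgroup Y.DeltaTemp, ∃ H' : CharOpenSubgroup Y.DeltaTemp,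
      (cofreeCore H'.toSubgroup).subgroupOf Y.DeltaTemp ≤ N.toSubgroup)
    (N : OpenNormalSubgroup Y.PiTemp) :
    ∃ H' : CharOpenSubgroup Y.DeltaTemp, cofreeCore H'.toSubgroup ≤ N.toSubgroup := by
  let NΔ : OpenNormalSubgroup Y.DeltaTemp :=
    ⟨⟨N.toSubgroup.subgroupOf Y.DeltaTemp, N.isOpen.preimage continuous_subtype_val⟩, inferInstance⟩
  obtain ⟨H', hH'⟩ := hΔ NΔ
  refine ⟨H', fun x hx => ?_⟩
  have hxΔ : x ∈ Y.DeltaTemp := H'.le (cofreeCore_le _ hx)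
  have h := hH' (Subgroup.mem_subgroupOf.mpr (show ((⟨x, hxΔ⟩ : Y.DeltaTemp) : Y.PiTemp) ∈
    cofreeCore H'.toSubgroup from hx))
  exact Subgroup.mem_subgroupOf.mp h

/-- **(CF) ⟹ (CF_Δ)** for `Π^tp_Y` tempered ([SemiAnbd] Def 3.1 (i): open normal subgroups form a
basis of neighbourhoods of `1`): an open normal subgroup of `Δ^tp_Y` is the trace of an open set of
`Π^tp_Y`, which contains an open normal subgroup of `Π^tp_Y`, which contains some `H′^{co-fr}`.
[cite: MochizukiAbsTopI2012, Prop 4.10 (i) p.60] -/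
theorem cofreeCore_cofinal_delta_of_isTempered {Y : TemperedCurve p} (hT : IsTempered Y.PiTemp)
    (h : ∀ N : OpenNormalSubgroup Y.PiTemp, ∃ H' : CharOpenSubgroup Y.DeltaTemp,
      cofreeCore H'.toSubgroup ≤ N.toSubgroup)
    (N : OpenNormalSubgroup Y.DeltaTemp) :
    ∃ H' : CharOpenSubgroup Y.DeltaTemp,
      (cofreeCore H'.toSubgroup).subgroupOf Y.DeltaTemp ≤ N.toSubgroup := by
  obtain ⟨U, hUo, hUN⟩ := isOpen_induced_iff.mp N.isOpen
  have h1U : (1 : Y.PiTemp) ∈ U := by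
    have h1 : (1 : Y.DeltaTemp) ∈ Subtype.val ⁻¹' U := by rw [hUN]; exact N.toSubgroup.one_mem
    exact h1
  obtain ⟨N₀, -, hN₀U⟩ := hT.basis U (hUo.mem_nhds h1U)
  obtain ⟨H', hH'⟩ := h N₀
  refine ⟨H', fun x hx => ?_⟩
  have hxU : x ∈ Subtype.val ⁻¹' U := hN₀U (hH' (Subgroup.mem_subgroupOf.mp hx))
  rw [hUN] at hxU
  exact hxU

/-- **(CF) ⟺ (CF_Δ)** for `Π^tp_Y` tempered: André's basis clause is a property of the GEOMETRIC
tempered group `Δ^tp_Y` (with its co-free cores) alone.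
[cite: MochizukiAbsTopI2012, Prop 4.10 (i) p.60] -/
theorem cofreeCore_cofinal_iff_delta {Y : TemperedCurve p} (hT : IsTempered Y.PiTemp) :
    (∀ N : OpenNormalSubgroup Y.PiTemp, ∃ H' : CharOpenSubgroup Y.DeltaTemp,
        cofreeCore H'.toSubgroup ≤ N.toSubgroup) ↔
      ∀ N : OpenNormalSubgroup Y.DeltaTemp, ∃ H' : CharOpenSubgroup Y.DeltaTemp,
        (cofreeCore H'.toSubgroup).subgroupOf Y.DeltaTemp ≤ N.toSubgroup :=
  ⟨cofreeCore_cofinal_delta_of_isTempered hT, cofreeCore_cofinal_of_delta⟩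

/-! ### Row iii.L02 ⟺ (CF) ⟺ (CF_Δ) -/

/-- **Row iii.L02 ⟺ André's (CF)**: for `Π^tp_Y` tempered, Galois-countable
(`dY : Y.GroupLevelData`) and every Y-index admitting a minimal co-free subgroup ([AbsTopI] §0
p. 8), Prop 4.10 (i) AT THE CONSTRUCTION (`SelfCompletionAt Y`) holds iff every open normal
subgroup of `Π^tp_Y` contains some `H′^{co-fr}`.  (⟹: the `K_{H′}` are cofinal,
`SelfCompletionAt.exists_piKer_le`, and `H′^{co-fr} ≤ K_{H′}`; ⟸:
`selfCompletionAt_of_cofreeCore_cofinal`, through (PC).)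
[cite: MochizukiAbsTopI2012, Prop 4.10 (i) p.60] -/
theorem selfCompletionAt_iff_cofreeCore_cofinal {Y : TemperedCurve p} (dY : Y.GroupLevelData)
    (hmin : ∀ H' : CharOpenSubgroup Y.DeltaTemp, ∃ M, IsMinimalCofreeIn H'.toSubgroup M) :
    SelfCompletionAt Y ↔
      ∀ N : OpenNormalSubgroup Y.PiTemp, ∃ H' : CharOpenSubgroup Y.DeltaTemp,
        cofreeCore H'.toSubgroup ≤ N.toSubgroup := by
  constructor
  · intro hY N
    obtain ⟨H', hH'⟩ := hY.exists_piKer_le N.toOpenSubgroup.mem_nhds_one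
    exact ⟨H', (cofreeCore_le_ker_toCoFreeQuot _ H'.toSubgroup).trans fun z hz => hH' hz⟩
  · exact selfCompletionAt_of_cofreeCore_cofinal dY hmin

/-- **Row iii.L02 ⟺ (CF_Δ)**: the same with the basis clause placed on the geometric group
`Δ^tp_Y`. [cite: MochizukiAbsTopI2012, Prop 4.10 (i) p.60] -/
theorem selfCompletionAt_iff_cofreeCore_cofinal_delta {Y : TemperedCurve p}
    (dY : Y.GroupLevelData)
    (hmin : ∀ H' : CharOpenSubgroup Y.DeltaTemp, ∃ M, IsMinimalCofreeIn H'.toSubgroup M) :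
    SelfCompletionAt Y ↔
      ∀ N : OpenNormalSubgroup Y.DeltaTemp, ∃ H' : CharOpenSubgroup Y.DeltaTemp,
        (cofreeCore H'.toSubgroup).subgroupOf Y.DeltaTemp ≤ N.toSubgroup := by
  rw [selfCompletionAt_iff_cofreeCore_cofinal dY hmin, cofreeCore_cofinal_iff_delta dY.isTempered]

/-! ### Node (iii), both clauses, over (CF_Δ) -/

/-- **[AbsTopI] Prop 4.10 (iii), Π-clause, AT THE CONSTRUCTION** with the topological residue placed
on the geometric group: (CF_Δ) "every open normal subgroup of `Δ^tp_Y` contains some `H′^{co-fr}`"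
replaces (CF) in `prop410iiiAt_of_residues''`. [cite: MochizukiAbsTopI2012, Prop 4.10 (iii) p.60] -/
theorem prop410iiiAt_of_residues''' {X Y : TemperedCurve p} (E : DeCuspidalization X Y)
    (hΔ : ∀ N : OpenNormalSubgroup Y.DeltaTemp, ∃ H' : CharOpenSubgroup Y.DeltaTemp,
      (cofreeCore H'.toSubgroup).subgroupOf Y.DeltaTemp ≤ N.toSubgroup)
    (hleft : ∀ H : CharOpenSubgroup X.DeltaTemp, ∃ H' : CharOpenSubgroup Y.DeltaTemp,
      coFreeKernel ((ContinuousMonoidHom.id Y.PiHat).comp Y.toHat) H'.toSubgroup ≤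
        coFreeKernel (E.fHat.comp X.toHat) H.toSubgroup)
    (hfg : IsTopologicallyFinitelyGenerated X.DeltaHat) (hK : X.K = Y.K)
    (dX : X.GroupLevelData) (dY : Y.GroupLevelData)
    (hR2 : ∀ H' : CharOpenSubgroup Y.DeltaTemp,
      H'.toSubgroup ≤ (H'.toSubgroup.comap E.f.toMonoidHom).map E.f.toMonoidHom ⊔
        cofreeCore H'.toSubgroup)
    (hmin : ∀ H' : CharOpenSubgroup Y.DeltaTemp, ∃ M, IsMinimalCofreeIn H'.toSubgroup M) :
    Prop410iiiAt E :=
  prop410iiiAt_of_residues'' E (cofreeCore_cofinal_of_delta hΔ) hleft hfg hK dX dY hR2 hmin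

/-- **[AbsTopI] Prop 4.10 (iii), Δ-clause, AT THE CONSTRUCTION** over the same residues with (CF_Δ).
[cite: MochizukiAbsTopI2012, Prop 4.10 (iii) p.60] -/
theorem prop410iiiDeltaAt_of_residues''' {X Y : TemperedCurve p} (E : DeCuspidalization X Y)
    (hΔ : ∀ N : OpenNormalSubgroup Y.DeltaTemp, ∃ H' : CharOpenSubgroup Y.DeltaTemp,
      (cofreeCore H'.toSubgroup).subgroupOf Y.DeltaTemp ≤ N.toSubgroup)
    (hleft : ∀ H : CharOpenSubgroup X.DeltaTemp, ∃ H' : CharOpenSubgroup Y.DeltaTemp,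
      coFreeKernel ((ContinuousMonoidHom.id Y.PiHat).comp Y.toHat) H'.toSubgroup ≤
        coFreeKernel (E.fHat.comp X.toHat) H.toSubgroup)
    (hfg : IsTopologicallyFinitelyGenerated X.DeltaHat) (hK : X.K = Y.K)
    (dX : X.GroupLevelData) (dY : Y.GroupLevelData)
    (hR2 : ∀ H' : CharOpenSubgroup Y.DeltaTemp,
      H'.toSubgroup ≤ (H'.toSubgroup.comap E.f.toMonoidHom).map E.f.toMonoidHom ⊔
        cofreeCore H'.toSubgroup)
    (hmin : ∀ H' : CharOpenSubgroup Y.DeltaTemp, ∃ M, IsMinimalCofreeIn H'.toSubgroup M) :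
    Prop410iiiDeltaAt E :=
  prop410iiiDeltaAt_of_residues'' E (cofreeCore_cofinal_of_delta hΔ) hleft hfg hK dX dY hR2 hmin

end Literature.AnabelianGeometry.AbsoluteAnabelian.AbsTopI.Prop410

end
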